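import Summits.AtomisticToContinuum.HydrodynamicLimit.Theorems.ImplosionDichotomyHydroLimitInBandWindowBalance
import HarnessLib

/-!
# Crux `SpeedCapSurgery.CappedEulerLimit` (stmt-AtomisticToContinuum-17739), line `registered`, stub `toReal_klDiv_lawAt_restrict_eq_integral`

THE RELATIVE ENTROPY OF THE EVOLVED RESTRICTED LOCAL GIBBS LAW, MADE EXPLICIT. Yau's relative-entropy method
for the hard-sphere system on `𝕋³` at `σ ≤ 1/2`, started from the local Gibbs law
`λ_N = localGibbsLaw σ a₀ u₀ θ₀ N Φ` RESTRICTED to a measurable set `S` of initial data (the crux restricts to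
the speed-cap event): the evolved restricted law `(Φ_t)_* (λ_N|_S) = lawAt Φ (λ_N.restrict S) t` is a
sub-probability law of mass `λ_N(S)`, and for a local Gibbs reference `ψ_N = localGibbsLaw σ b w ϑ N Φ` with
continuous positive profiles

  `KL((Φ_t)_* (λ_N|_S) ‖ ψ_N) = ∫_S [G_λ(z) − G_ψ(Φ_t z)] dλ_N + λ_N(S) · (log Z_pos(b) − log Z_pos(a₀)) + (1 − λ_N(S))`,

where `G_•(z) = Σ_i g_•(z_i)`, `g_ψ(x, v) = log b(x) − (3/2) log(2πϑ(x)) − |v − w(x)|²/(2ϑ(x))` is the logarithm of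
the density of `ψ_N` w.r.t. the Liouville measure up to the constant `−log Z_pos(b)` (`Z_pos = posPartition`),
and Mathlib's `klDiv μ ν` for a finite `μ` carries the mass correction `+ ν(univ) − μ(univ) = 1 − λ_N(S)`.
This is the restricted twin of `EntropyClockDock.toReal_klDiv_lawAt_eq_integral` (`S = univ`).

* §1 `toReal_klDiv_lawAt_restrict_withDensity` — abstract form over a hard-sphere flow: for densities `f`, `g`
  w.r.t. the Liouville measure `dZ`, `KL((Φ_t)_* ((f dZ)|_S) ‖ g dZ) = ∫_S (log f − log (g ∘ Φ_t)) f dZ + ∫ g dZ − ∫_S f dZ`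
  (the restricted law has density `1_S f`: `restrict_withDensity`, `withDensity_indicator`; transport
  `klDiv_lawAt_withDensity_eq`; explicit KL `toReal_klDiv_withDensity`; Liouville invariance `lintegral_comp_flow`).
* §2 `toReal_klDiv_lawAt_restrict_localGibbsLaw` — local Gibbs currency (log canonical densities), and the
  registered stub `toReal_klDiv_lawAt_restrict_eq_integral` (explicit one-body log-densities
  `EntropyClockDock.ae_logRatio_eq_oneBody`, integrability `EntropyClockDock.integrable_oneBodySum(_flow)`).

Worker file of the lead prover-line-stmt-AtomisticToContinuum-17739-c1-0 (`--supports stmt-AtomisticToContinuum-17739`).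

References: H.-T. Yau, *Relative entropy and hydrodynamics of Ginzburg–Landau models*, Lett. Math. Phys. 22
(1991), §2; S. Olla, S. R. S. Varadhan, H.-T. Yau, Comm. Math. Phys. 155 (1993), §3.
-/

noncomputable section

namespace Summit.AtomisticToContinuum.HydrodynamicLimit.Theorems.CappedEulerLimit

open scoped ENNReal NNReal Topology
open MeasureTheory Filter Set InformationTheory
open Literature.Analysis.FluidPDE Literature.MathematicalPhysics.KineticTheory Literature.Analysis.FunctionSpaces
open Summit.AtomisticToContinuum.HydrodynamicLimit.Theorems

/-! ### §1 The abstract identity along a hard-sphere flow -/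

section Flow

variable {d : Type*} [Fintype d] {X : Type*} [MeasureSpace X] [TopologicalSpace X] {n : ℕ}
  {G : Geometry d X} {ε : ℝ}

/-- **KL of the evolved RESTRICTED law w.r.t. a reference density.** For a hard-sphere flow `Φ`, measurable
densities `f`, `g` w.r.t. the (σ-finite) Liouville measure `dZ` with finite laws, `g` a.e. positive and finite,
a measurable set `S` and `log f − log (g ∘ Φ_t)` integrable under `(f dZ)|_S`:
`KL((Φ_t)_* ((f dZ)|_S) ‖ g dZ) = ∫_S (log f − log (g ∘ Φ_t)) f dZ + ∫ g dZ − ∫_S f dZ`. The restricted law is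
`(1_S f) dZ` (`restrict_withDensity`, `withDensity_indicator`), the flow is transported onto the reference
(`klDiv_lawAt_withDensity_eq`, mass preserved by `lintegral_comp_flow`), the divergence of two laws with
densities is explicit (`toReal_klDiv_withDensity`), and on `S`, which carries `(f dZ)|_S`, `1_S f = f`. [folklore] -/
theorem toReal_klDiv_lawAt_restrict_withDensity (Φ : HardSphereFlow G ε n) [SigmaFinite (liouville G n ε)]
    {f g : Config n d X → ℝ≥0∞} (hf : Measurable f) (hg : Measurable g)
    [IsFiniteMeasure ((liouville G n ε).withDensity f)] [IsFiniteMeasure ((liouville G n ε).withDensity g)]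
    (hg0 : ∀ᵐ z ∂liouville G n ε, g z ≠ 0) (hgtop : ∀ᵐ z ∂liouville G n ε, g z ≠ ∞) (t : ℝ)
    {S : Set (Config n d X)} (hS : MeasurableSet S)
    (hint : Integrable (fun z => Real.log (f z).toReal - Real.log (g (Φ.flow t z)).toReal)
      (((liouville G n ε).withDensity f).restrict S)) :
    (klDiv (Φ.lawAt (((liouville G n ε).withDensity f).restrict S) t) ((liouville G n ε).withDensity g)).toReal =
      ∫ z in S, (Real.log (f z).toReal - Real.log (g (Φ.flow t z)).toReal) ∂((liouville G n ε).withDensity f) +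
        ((liouville G n ε).withDensity g).real univ - ((liouville G n ε).withDensity f).real S := by
  have hgt : Measurable fun z => g (Φ.flow t z) := hg.comp (Φ.measurable_flow t)
  -- the pulled-back reference has the same (finite) mass
  have hmass : ((liouville G n ε).withDensity fun z => g (Φ.flow t z)) univ =
      ((liouville G n ε).withDensity g) univ := by
    rw [withDensity_apply _ MeasurableSet.univ, withDensity_apply _ MeasurableSet.univ,
      Measure.restrict_univ, lintegral_comp_flow Φ hg t]
  haveI : IsFiniteMeasure ((liouville G n ε).withDensity fun z => g (Φ.flow t z)) :=
    ⟨by rw [hmass]; exact measure_lt_top _ _⟩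
  have hreal : ((liouville G n ε).withDensity fun z => g (Φ.flow t z)).real univ =
      ((liouville G n ε).withDensity g).real univ := by
    rw [measureReal_def, measureReal_def, hmass]
  -- a.e. positivity/finiteness of the pulled-back density (quasi-measure-preservation of `Φ_t`)
  have hq := (Φ.measurePreserving t).quasiMeasurePreserving
  have hgt0 : ∀ᵐ z ∂liouville G n ε, g (Φ.flow t z) ≠ 0 := hq.ae hg0
  have hgttop : ∀ᵐ z ∂liouville G n ε, g (Φ.flow t z) ≠ ∞ := hq.ae hgtop
  -- the restricted law has density `1_S f`
  have hres : ((liouville G n ε).withDensity f).restrict S =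
      (liouville G n ε).withDensity (S.indicator f) := by
    rw [restrict_withDensity hS, withDensity_indicator hS]
  haveI : IsFiniteMeasure ((liouville G n ε).withDensity (S.indicator f)) := by
    rw [← hres]; infer_instance
  -- on `S`, which carries the restricted law, the indicator is invisible
  have hae : ∀ᵐ z ∂((liouville G n ε).withDensity f).restrict S,
      Real.log (S.indicator f z).toReal - Real.log (g (Φ.flow t z)).toReal =
        Real.log (f z).toReal - Real.log (g (Φ.flow t z)).toReal := by
    filter_upwards [ae_restrict_mem hS] with z hz
    rw [Set.indicator_of_mem hz]
  have hint' : Integrable (fun z => Real.log (S.indicator f z).toReal - Real.log (g (Φ.flow t z)).toReal)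
      ((liouville G n ε).withDensity (S.indicator f)) := by
    rw [← hres]
    exact hint.congr (hae.mono fun z hz => hz.symm)
  rw [hres, klDiv_lawAt_withDensity_eq Φ hg t,
    toReal_klDiv_withDensity (liouville G n ε) (hf.indicator hS) hgt hgt0 hgttop hint', ← hres,
    integral_congr_ae hae, hreal, measureReal_restrict_apply_univ]

end Flow

/-! ### §2 The local Gibbs currency and the registered stub -/

/-- **KL of the evolved restricted local Gibbs law w.r.t. a local Gibbs reference, via the canonical
densities.** For the hard-sphere system on `𝕋³` at `σ ≤ 1/2` started from `λ_N = localGibbsLaw σ a₀ u₀ θ₀ N Φ`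
restricted to a measurable `S`, and a local Gibbs reference `ψ_N` with continuous positive profiles `(b, w, ϑ)`,
writing `ρ_λ`, `ρ_ψ` for the canonical densities:
`KL(lawAt Φ (λ_N|_S) t ‖ ψ_N) = ∫_S [log ρ_λ(z) − log ρ_ψ(Φ_t z)] dλ_N + 1 − λ_N(S)` (real parts), provided the
log-ratio is `λ_N|_S`-integrable — `toReal_klDiv_lawAt_restrict_withDensity` with `ψ_N` a probability measure.
[cite: Yau1991, §2] -/
theorem toReal_klDiv_lawAt_restrict_localGibbsLaw {σ : ℝ} (hσ2 : σ ≤ 1 / 2) {a₀ θ₀ : T3 → ℝ}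
    {u₀ : T3 → V3} (ha : Continuous a₀) (hθ : Continuous θ₀) (hu : Continuous u₀) (ha0 : ∀ x, 0 < a₀ x)
    (hθ0 : ∀ x, 0 < θ₀ x) {b ϑ : T3 → ℝ} {w : T3 → V3} (hb : Continuous b) (hϑ : Continuous ϑ)
    (hw : Continuous w) (hb0 : ∀ x, 0 < b x) (hϑ0 : ∀ x, 0 < ϑ x) (N : ℕ)
    (Φ : HardSphereFlow (Torus.geometry (Fin 3)) (hsDiameter σ N) (N + 1)) (t : ℝ)
    {S : Set (Config (N + 1) (Fin 3) T3)} (hS : MeasurableSet S)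
    (hint : Integrable (fun z =>
        Real.log (canonicalDensity (Torus.geometry (Fin 3)) (hsDiameter σ N) (N + 1)
          (localGibbsProfile a₀ u₀ θ₀) z) -
        Real.log (canonicalDensity (Torus.geometry (Fin 3)) (hsDiameter σ N) (N + 1)
          (localGibbsProfile b w ϑ) (Φ.flow t z))) ((localGibbsLaw σ a₀ u₀ θ₀ N Φ).restrict S)) :
    (klDiv (Φ.lawAt ((localGibbsLaw σ a₀ u₀ θ₀ N Φ).restrict S) t) (localGibbsLaw σ b w ϑ N Φ)).toReal =
      (∫ z in S, (Real.log (canonicalDensity (Torus.geometry (Fin 3)) (hsDiameter σ N) (N + 1)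
            (localGibbsProfile a₀ u₀ θ₀) z) -
          Real.log (canonicalDensity (Torus.geometry (Fin 3)) (hsDiameter σ N) (N + 1)
            (localGibbsProfile b w ϑ) (Φ.flow t z))) ∂(localGibbsLaw σ a₀ u₀ θ₀ N Φ)) +
        1 - (localGibbsLaw σ a₀ u₀ θ₀ N Φ).real S := by
  -- σ-finiteness of the Liouville measure (instance path made explicit)
  haveI hXE : SigmaFinite (volume : Measure (T3 × V3)) := inferInstance
  haveI hC : SigmaFinite (volume : Measure (Config (N + 1) (Fin 3) T3)) := inferInstance
  haveI hL : SigmaFinite (liouville (Torus.geometry (Fin 3)) (N + 1) (hsDiameter σ N)) := by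
    rw [liouville_eq]; infer_instance
  -- the two laws as densities w.r.t. the Liouville measure (definitional)
  have hdens : ∀ (a θ : T3 → ℝ) (u : T3 → V3), localGibbsLaw σ a u θ N Φ =
      (liouville (Torus.geometry (Fin 3)) (N + 1) (hsDiameter σ N)).withDensity fun z =>
        ENNReal.ofReal (canonicalDensity (Torus.geometry (Fin 3)) (hsDiameter σ N) (N + 1)
          (localGibbsProfile a u θ) z) := fun a θ u => rfl
  have hm : ∀ {a θ : T3 → ℝ} {u : T3 → V3}, Continuous a → Continuous θ → Continuous u →
      Measurable fun z => ENNReal.ofReal (canonicalDensity (Torus.geometry (Fin 3)) (hsDiameter σ N)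
        (N + 1) (localGibbsProfile a u θ) z) := fun ha hθ hu =>
    (measurable_canonicalDensity _ _ (measurable_localGibbsProfile ha hθ hu)).ennreal_ofReal
  haveI i₀ : IsProbabilityMeasure (localGibbsLaw σ a₀ u₀ θ₀ N Φ) :=
    isProbabilityMeasure_localGibbsLaw ha hθ hu ha0 hθ0 hσ2 N Φ
  haveI i₂ : IsProbabilityMeasure (localGibbsLaw σ b w ϑ N Φ) :=
    isProbabilityMeasure_localGibbsLaw hb hϑ hw hb0 hϑ0 hσ2 N Φ
  haveI j₀ : IsFiniteMeasure ((liouville (Torus.geometry (Fin 3)) (N + 1) (hsDiameter σ N)).withDensity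
      fun z => ENNReal.ofReal (canonicalDensity (Torus.geometry (Fin 3)) (hsDiameter σ N) (N + 1)
        (localGibbsProfile a₀ u₀ θ₀) z)) := by rw [← hdens]; infer_instance
  haveI j₂ : IsFiniteMeasure ((liouville (Torus.geometry (Fin 3)) (N + 1) (hsDiameter σ N)).withDensity
      fun z => ENNReal.ofReal (canonicalDensity (Torus.geometry (Fin 3)) (hsDiameter σ N) (N + 1)
        (localGibbsProfile b w ϑ) z)) := by rw [← hdens]; infer_instance
  -- pointwise `toReal ∘ ofReal = id` on the (nonnegative) densities
  have hto : ∀ {a θ : T3 → ℝ} {u : T3 → V3}, (∀ x, 0 < a x) → (∀ x, 0 < θ x) →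
      ∀ z : Config (N + 1) (Fin 3) T3, (ENNReal.ofReal (canonicalDensity (Torus.geometry (Fin 3))
        (hsDiameter σ N) (N + 1) (localGibbsProfile a u θ) z)).toReal =
        canonicalDensity (Torus.geometry (Fin 3)) (hsDiameter σ N) (N + 1) (localGibbsProfile a u θ) z :=
    fun ha0 hθ0 z => ENNReal.toReal_ofReal (canonicalDensity_localGibbsProfile_nonneg
      (fun x => (ha0 x).le) (fun x => (hθ0 x).le) _ _ _)
  -- the abstract identity
  have key := toReal_klDiv_lawAt_restrict_withDensity Φ (hm ha hθ hu) (hm hb hϑ hw)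
    (ae_canonicalDensity_localGibbsProfile_ne_zero hb hϑ hw hb0 hϑ0 hσ2 N)
    (Eventually.of_forall fun z => ENNReal.ofReal_ne_top) t hS
    (by
      rw [← hdens]
      refine hint.congr (Eventually.of_forall fun z => ?_)
      simp only [hto ha0 hθ0, hto hb0 hϑ0])
  -- rewrite the laws as local Gibbs laws and use the unit mass of the reference
  rw [← hdens, ← hdens] at key
  rw [key, probReal_univ]
  congr 2
  refine integral_congr_ae (Eventually.of_forall fun z => ?_)
  simp only [hto ha0 hθ0, hto hb0 hϑ0]

/-- **`KL((Φ_t)_* (λ_N|_S) ‖ ψ_N)` made explicit** (registered stub of line `registered`, crux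
`SpeedCapSurgery.CappedEulerLimit`). For `σ ≤ 1/2`, continuous positive profiles `(a₀, u₀, θ₀)` of
`λ_N = localGibbsLaw σ a₀ u₀ θ₀ N Φ`, a continuous positive reference `ψ = (b, w, ϑ)` and a measurable set `S` of
initial data:
`KL(lawAt Φ (λ_N|_S) t ‖ ψ_N) = ∫_S [G_λ(z) − G_ψ(Φ_t z)] dλ_N + λ_N(S) · (log Z_pos(b) − log Z_pos(a₀)) + (1 − λ_N(S))`
with `G_ψ(z) = Σ_i (log b(x_i) − (3/2) log(2πϑ(x_i)) − |v_i − w(x_i)|²/(2ϑ(x_i)))`: the local Gibbs currency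
`toReal_klDiv_lawAt_restrict_localGibbsLaw`, the explicit log-densities `EntropyClockDock.ae_logRatio_eq_oneBody`
(restricted from `λ_N`-a.e. to `λ_N|_S`-a.e.), the integrability of the one-body sums
(`EntropyClockDock.integrable_oneBodySum(_flow)`), and the mass defect `1 − λ_N(S)` of the sub-probability law
`λ_N|_S` in Mathlib's `klDiv`. The restricted twin of `EntropyClockDock.toReal_klDiv_lawAt_eq_integral`.
[cite: Yau1991, §2] -/
theorem toReal_klDiv_lawAt_restrict_eq_integral {σ : ℝ} (hσ2 : σ ≤ 1 / 2) {a₀ θ₀ : T3 → ℝ} {u₀ : T3 → V3}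
    (ha : Continuous a₀) (hθ : Continuous θ₀) (hu : Continuous u₀) (ha0 : ∀ x, 0 < a₀ x)
    (hθ0 : ∀ x, 0 < θ₀ x) {b ϑ : T3 → ℝ} {w : T3 → V3} (hb : Continuous b) (hϑ : Continuous ϑ)
    (hw : Continuous w) (hb0 : ∀ x, 0 < b x) (hϑ0 : ∀ x, 0 < ϑ x) (N : ℕ)
    (Φ : HardSphereFlow (Torus.geometry (Fin 3)) (hsDiameter σ N) (N + 1)) (t : ℝ)
    {S : Set (Config (N + 1) (Fin 3) T3)} (hS : MeasurableSet S) :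
    (klDiv (Φ.lawAt ((localGibbsLaw σ a₀ u₀ θ₀ N Φ).restrict S) t) (localGibbsLaw σ b w ϑ N Φ)).toReal =
      (∫ z in S, ((∑ i, (Real.log (a₀ (z i).1) - 3 / 2 * Real.log (2 * Real.pi * θ₀ (z i).1) -
            ‖(z i).2 - u₀ (z i).1‖ ^ 2 / (2 * θ₀ (z i).1))) -
          ∑ i, (Real.log (b (Φ.flow t z i).1) - 3 / 2 * Real.log (2 * Real.pi * ϑ (Φ.flow t z i).1) -
            ‖(Φ.flow t z i).2 - w (Φ.flow t z i).1‖ ^ 2 / (2 * ϑ (Φ.flow t z i).1)))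
        ∂(localGibbsLaw σ a₀ u₀ θ₀ N Φ)) +
      (localGibbsLaw σ a₀ u₀ θ₀ N Φ S).toReal *
        (Real.log (posPartition b (hsDiameter σ N) (N + 1)) -
          Real.log (posPartition a₀ (hsDiameter σ N) (N + 1))) +
      (1 - (localGibbsLaw σ a₀ u₀ θ₀ N Φ S).toReal) := by
  haveI := isProbabilityMeasure_localGibbsLaw ha hθ hu ha0 hθ0 hσ2 N Φ
  -- the one-body difference is integrable under `λ_N`, hence under `λ_N|_S`
  have hsum : Integrable (fun z : Config (N + 1) (Fin 3) T3 =>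
      (∑ i, (Real.log (a₀ (z i).1) - 3 / 2 * Real.log (2 * Real.pi * θ₀ (z i).1) -
          ‖(z i).2 - u₀ (z i).1‖ ^ 2 / (2 * θ₀ (z i).1))) -
        ∑ i, (Real.log (b (Φ.flow t z i).1) - 3 / 2 * Real.log (2 * Real.pi * ϑ (Φ.flow t z i).1) -
          ‖(Φ.flow t z i).2 - w (Φ.flow t z i).1‖ ^ 2 / (2 * ϑ (Φ.flow t z i).1)))
      ((localGibbsLaw σ a₀ u₀ θ₀ N Φ).restrict S) :=
    ((EntropyClockDock.integrable_oneBodySum hσ2 ha hθ hu ha0 hθ0 ha hθ hu ha0 hθ0 N Φ).sub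
      (EntropyClockDock.integrable_oneBodySum_flow hσ2 ha hθ hu ha0 hθ0 hb hϑ hw hb0 hϑ0 N Φ t)).restrict
  -- the log-ratio of the canonical densities is the one-body difference plus a constant, `λ_N|_S`-a.e.
  have hae := ae_restrict_of_ae (s := S)
    (EntropyClockDock.ae_logRatio_eq_oneBody hσ2 a₀ θ₀ u₀ ha hθ hu ha0 hθ0 hb hϑ hw hb0 hϑ0 N Φ t)
  rw [toReal_klDiv_lawAt_restrict_localGibbsLaw hσ2 ha hθ hu ha0 hθ0 hb hϑ hw hb0 hϑ0 N Φ t hS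
      ((hsum.add (integrable_const _)).congr (hae.mono fun z hz => hz.symm)),
    integral_congr_ae hae, integral_add hsum (integrable_const _), integral_const,
    measureReal_restrict_apply_univ, smul_eq_mul, measureReal_def]
  ring

end Summit.AtomisticToContinuum.HydrodynamicLimit.Theorems.CappedEulerLimit

end
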